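import Summits.ResolutionOfSingularities.ResolutionOfSingularities.Theorems.FrobeniusLadderFInjectiveMacaulayficationSopFrobeniusPower
import HarnessLib

/-!
# Position monomials on a list `Zl.map z ++ t`: `∏ s[q]^(e q)` with `e q = M (Zl[q])` on the first block is `∏_{i ∈ Zl} (z i)^(M i)`
# (BED Ω₁ GLOBAL PATCH, F6 v2: bookkeeping between the letter-indexed exponent tables `M₁|Z, M₂|Z, r|Z, s|Z` and the position-indexed monomials of ✓ `SopFrobeniusPower` /
# ✓ `PencilPointRecipes`; crux `FInjectiveMacaulayfication` stmt-ResolutionOfSingularities-15315, chain w45a; seat res-L1-w45a-stub-3 g15)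

[OURS · L1 W4.5a] Support file (`--supports stmt-ResolutionOfSingularities-15315 --as helper`); theorems only; GENERIC; no named fact; NOT a statement of any manuscript; nothing of the
crux is proved. AI-written (AI review is weaker than expert review).
* `prod_fin_getElem_pow_eq_prod_mapIdx` — `∏_{q : Fin s.length} s[q]^(e q) = (s.mapIdx (q x ↦ x^(e q))).prod`;
* ★ `prod_getElem_pow_append_eq` — for `Zl` without repetition: `∏_q (Zl.map z ++ t)[q]^(if q < |Zl| then M (Zl[q]) else 0) = ∏_{i ∈ Zl.toFinset} (z i)^(M i)`;
* `prod_getElem_pow_indicator` — `∏_q s[q]^(if q = q₀ then 1 else 0) = s[q₀]`; `getElem_append_length` — `(Zl.map z ++ (w :: t))[|Zl|] = w`;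
* ★ `prod_getElem_pow_append_cons_eq` — the exponent `(if q < |Zl| then M (Zl[q]) else 0) + (if q = |Zl| then 1 else 0)` on `Zl.map z ++ (w :: t)` gives `(∏_{i ∈ Zl} (z i)^(M i))·w`.
[folklore bookkeeping]
-/

set_option linter.dupNamespace false

noncomputable section

namespace Summit.ResolutionOfSingularities.ResolutionOfSingularities.Theorems.FInjectiveMacaulayfication.RsopPositionMonomials

open Summit.ResolutionOfSingularities.ResolutionOfSingularities.Theorems.FInjectiveMacaulayfication SopFrobeniusPower

universe u v

variable {B : Type u} [CommRing B] {ι : Type v}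

/-- `∏_{q : Fin s.length} s[q]^(e q) = (s.mapIdx (fun q x => x^(e q))).prod`. [folklore] -/
theorem prod_fin_getElem_pow_eq_prod_mapIdx (s : List B) (e : ℕ → ℕ) :
    (∏ q : Fin s.length, s[q] ^ e q) = (s.mapIdx fun q x => x ^ e q).prod := by
  induction s generalizing e with
  | nil => rw [List.mapIdx_nil, List.prod_nil]; exact Finset.prod_empty
  | cons a rest ih =>
    refine (Fin.prod_univ_succ (fun q : Fin (rest.length + 1) => (a :: rest)[q] ^ e q)).trans ?_
    rw [List.mapIdx_cons, List.prod_cons]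
    congr 1
    simp only [Fin.val_succ]
    exact ih (fun q => e (q + 1))

/-- ★ **Letter exponents on the first block.** For `Zl` without repetition, `∏_q (Zl.map z ++ t)[q]^(if q < |Zl| then M (Zl[q]) else 0) = ∏_{i ∈ Zl.toFinset} (z i)^(M i)`. [folklore] -/
theorem prod_getElem_pow_append_eq [DecidableEq ι] (Zl : List ι) (hZl : Zl.Nodup) (z : ι → B) (t : List B) (M : ι → ℕ) :
    (∏ q : Fin (Zl.map z ++ t).length, (Zl.map z ++ t)[q] ^ (if h : (q : ℕ) < Zl.length then M (Zl[(q : ℕ)]) else 0)) = ∏ i ∈ Zl.toFinset, z i ^ M i := by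
  induction Zl with
  | nil =>
    rw [List.toFinset_nil, Finset.prod_empty]
    exact Finset.prod_eq_one fun q _ => by rw [dif_neg (by simp), pow_zero]
  | cons i Zl' ih =>
    have hi : i ∉ Zl' := (List.nodup_cons.mp hZl).1
    have hZl' : Zl'.Nodup := (List.nodup_cons.mp hZl).2
    rw [List.toFinset_cons, Finset.prod_insert (fun h => hi (List.mem_toFinset.mp h)), ← ih hZl']
    rw [prod_fin_getElem_pow_eq_prod_mapIdx ((i :: Zl').map z ++ t) (fun q => if h : q < (i :: Zl').length then M ((i :: Zl')[q]) else 0),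
      prod_fin_getElem_pow_eq_prod_mapIdx (Zl'.map z ++ t) (fun q => if h : q < Zl'.length then M (Zl'[q]) else 0)]
    rw [List.map_cons, List.cons_append, List.mapIdx_cons, List.prod_cons]
    congr 1
    simp

omit [CommRing B] in
/-- `(Zl.map z ++ (w :: t))[|Zl|] = w`. [plumbing] -/
theorem getElem_append_length (Zl : List ι) (z : ι → B) (w : B) (t : List B) (h : Zl.length < (Zl.map z ++ (w :: t)).length) :
    (Zl.map z ++ (w :: t))[Zl.length] = w := by
  rw [List.getElem_append_right (by simp)]
  simp

/-- `∏_q s[q]^(if q = q₀ then 1 else 0) = s[q₀]`. [plumbing] -/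
theorem prod_getElem_pow_indicator (s : List B) (q₀ : Fin s.length) :
    (∏ q : Fin s.length, s[q] ^ (if (q : ℕ) = q₀ then 1 else 0)) = s[q₀] := by
  rw [Finset.prod_eq_single q₀]
  · rw [if_pos rfl, pow_one]
  · intro q _ hq
    rw [if_neg (fun h => hq (Fin.ext h)), pow_zero]
  · intro h; exact absurd (Finset.mem_univ q₀) h

/-- ★ **Letter exponents on the first block plus the letter `w` right after it.** [folklore] -/
theorem prod_getElem_pow_append_cons_eq [DecidableEq ι] (Zl : List ι) (hZl : Zl.Nodup) (z : ι → B) (w : B) (t : List B) (M : ι → ℕ) :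
    (∏ q : Fin (Zl.map z ++ (w :: t)).length, (Zl.map z ++ (w :: t))[q] ^
        ((if h : (q : ℕ) < Zl.length then M (Zl[(q : ℕ)]) else 0) + (if (q : ℕ) = Zl.length then 1 else 0))) = (∏ i ∈ Zl.toFinset, z i ^ M i) * w := by
  have hlen : Zl.length < (Zl.map z ++ (w :: t)).length := by simp
  rw [← prod_pow_mul_prod_pow (Zl.map z ++ (w :: t)) (fun q => if h : q < Zl.length then M (Zl[q]) else 0) (fun q => if q = Zl.length then 1 else 0),
    prod_getElem_pow_append_eq Zl hZl z (w :: t) M]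
  congr 1
  have h := prod_getElem_pow_indicator (Zl.map z ++ (w :: t)) ⟨Zl.length, hlen⟩
  rw [h]
  exact getElem_append_length Zl z w t hlen

end Summit.ResolutionOfSingularities.ResolutionOfSingularities.Theorems.FInjectiveMacaulayfication.RsopPositionMonomials

end
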